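import Summits.CriticalPhenomena.PercolationContinuityZ3.Theorems.PercNearOneGluingNoHeavyLowerTailSahiOneStepSharedBitPrelim
import HarnessLib

/-!
# One shared coordinate: k-form of the collapse functional and the k-level inequality

Support file (prover prim-ineq-prove-3 gen 26; `--supports stmt-CriticalPhenomena-4575`; memo
`run/shared/lean/prim/prim-ineq-prove-3/FINDING-G26-ONE-SHARED-COORDINATE.md` §1, Step 1).  No definitions, no sorries.

Setting ("three chains, one shared bit", mass form): a two-point chain `z ∈ {0,1}` with weights `c`, a private chain `k ∈ {0..K}`
(weights `a`) for the first slot and a private chain `j ∈ {0..J}` (weights `b`) for the second; slot masses `α z k`, `β z j`; the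
simplex ball `L = {z + k + j < t}`.  The collapse functional (the one-step scheme's `osN` on this grid) is
`N′ = ℓ·Σ_H c α β + (Σ_L c α b)(Σ_L c a β) − ℓ·(Σ c α)(Σ c β)`, `ℓ = Σ_L c a b`.
* `kform` — conditioning on the first private index `k` (pure rearrangement);
* `klevel_ineq` — the abstract k-level comparison: Lagrange identity for the between-`k` covariance, the sign of the pairs inside /
  outside the window (`pairSum_le_window`), `ℓ ≥ ℓ_W`, and a cheap lower bound on the window terms.
-/

namespace Summit.CriticalPhenomena.PercolationContinuityZ3.Theorems

namespace SahiOneStep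

namespace ThreeChain

open Finset


/-- **k-form of the collapse functional.**  For the shared-bit three-chain functional
`N′ = ℓ·S_H(αβ) + S_L(α)·S_L(β) − ℓ·S(α)·S(β)` (first slot masses `α z k` on the chain `k`, second slot masses `β z j` on the
chain `j`, bit weights `c`), conditioning on `k` gives `N′ = ℓ·Σ_k D_k + (Σ_k Fh_k)(Σ_k a_k G_k)` with
`D_k = Σ_{z,j}[H] c α_{zk} β_{zj} − (Σ_z c α_{zk})(Σ_{z,j} c β_{zj})`. Pure rearrangement. [this work] -/
theorem kform (K J t : ℕ) (c a b : ℕ → ℝ) (α β : ℕ → ℕ → ℝ) :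
    (∑ z ∈ range 2, ∑ k ∈ range (K + 1), ∑ j ∈ range (J + 1), if z + k + j < t then c z * a k * b j else 0) *
          (∑ z ∈ range 2, ∑ k ∈ range (K + 1), ∑ j ∈ range (J + 1), if z + k + j < t then 0 else c z * α z k * β z j)
        + (∑ z ∈ range 2, ∑ k ∈ range (K + 1), ∑ j ∈ range (J + 1), if z + k + j < t then c z * α z k * b j else 0) *
          (∑ z ∈ range 2, ∑ k ∈ range (K + 1), ∑ j ∈ range (J + 1), if z + k + j < t then c z * a k * β z j else 0)
        - (∑ z ∈ range 2, ∑ k ∈ range (K + 1), ∑ j ∈ range (J + 1), if z + k + j < t then c z * a k * b j else 0) *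
          (∑ z ∈ range 2, ∑ k ∈ range (K + 1), c z * α z k) * (∑ z ∈ range 2, ∑ j ∈ range (J + 1), c z * β z j) =
      (∑ k ∈ range (K + 1), a k * ∑ z ∈ range 2, ∑ j ∈ range (J + 1), if z + k + j < t then c z * b j else 0) *
          (∑ k ∈ range (K + 1), ((∑ z ∈ range 2, ∑ j ∈ range (J + 1), if z + k + j < t then 0 else c z * α z k * β z j)
              - (∑ z ∈ range 2, c z * α z k) * (∑ z ∈ range 2, ∑ j ∈ range (J + 1), c z * β z j)))
        + (∑ k ∈ range (K + 1), ∑ z ∈ range 2, ∑ j ∈ range (J + 1), if z + k + j < t then c z * α z k * b j else 0) *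
          (∑ k ∈ range (K + 1), a k * ∑ z ∈ range 2, ∑ j ∈ range (J + 1), if z + k + j < t then c z * β z j else 0) := by
  have e1 : (∑ z ∈ range 2, ∑ k ∈ range (K + 1), ∑ j ∈ range (J + 1), if z + k + j < t then c z * a k * b j else 0) =
      ∑ k ∈ range (K + 1), a k * ∑ z ∈ range 2, ∑ j ∈ range (J + 1), if z + k + j < t then c z * b j else 0 := by
    rw [sum3_comm]
    refine Finset.sum_congr rfl fun k _ => ?_
    rw [Finset.mul_sum]
    refine Finset.sum_congr rfl fun z _ => ?_
    rw [Finset.mul_sum]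
    refine Finset.sum_congr rfl fun j _ => ?_
    split_ifs <;> ring
  have e2 : (∑ z ∈ range 2, ∑ k ∈ range (K + 1), ∑ j ∈ range (J + 1), if z + k + j < t then 0 else c z * α z k * β z j) =
      ∑ k ∈ range (K + 1), ∑ z ∈ range 2, ∑ j ∈ range (J + 1), if z + k + j < t then 0 else c z * α z k * β z j :=
    sum3_comm _ _ _
  have e3 : (∑ z ∈ range 2, ∑ k ∈ range (K + 1), ∑ j ∈ range (J + 1), if z + k + j < t then c z * α z k * b j else 0) =
      ∑ k ∈ range (K + 1), ∑ z ∈ range 2, ∑ j ∈ range (J + 1), if z + k + j < t then c z * α z k * b j else 0 :=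
    sum3_comm _ _ _
  have e4 : (∑ z ∈ range 2, ∑ k ∈ range (K + 1), ∑ j ∈ range (J + 1), if z + k + j < t then c z * a k * β z j else 0) =
      ∑ k ∈ range (K + 1), a k * ∑ z ∈ range 2, ∑ j ∈ range (J + 1), if z + k + j < t then c z * β z j else 0 := by
    rw [sum3_comm]
    refine Finset.sum_congr rfl fun k _ => ?_
    rw [Finset.mul_sum]
    refine Finset.sum_congr rfl fun z _ => ?_
    rw [Finset.mul_sum]
    refine Finset.sum_congr rfl fun j _ => ?_
    split_ifs <;> ring
  have e5 : (∑ z ∈ range 2, ∑ k ∈ range (K + 1), c z * α z k) = ∑ k ∈ range (K + 1), ∑ z ∈ range 2, c z * α z k :=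
    Finset.sum_comm
  rw [e1, e2, e3, e4, e5]
  have e6 : (∑ k ∈ range (K + 1), ((∑ z ∈ range 2, ∑ j ∈ range (J + 1), if z + k + j < t then 0 else c z * α z k * β z j)
              - (∑ z ∈ range 2, c z * α z k) * (∑ z ∈ range 2, ∑ j ∈ range (J + 1), c z * β z j))) =
      (∑ k ∈ range (K + 1), ∑ z ∈ range 2, ∑ j ∈ range (J + 1), if z + k + j < t then 0 else c z * α z k * β z j)
        - (∑ k ∈ range (K + 1), ∑ z ∈ range 2, c z * α z k) * (∑ z ∈ range 2, ∑ j ∈ range (J + 1), c z * β z j) := by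
    rw [Finset.sum_sub_distrib, Finset.sum_mul]
  rw [e6]; ring


/-- Shifting the private index into the radius: `[z + k + j < t] = [z + j < t − k]` (natural subtraction). [folklore] -/
theorem ballShift (J t k : ℕ) (w : ℕ → ℕ → ℝ) :
    (∑ z ∈ range 2, ∑ j ∈ range (J + 1), if z + k + j < t then w z j else 0) =
      ∑ z ∈ range 2, ∑ j ∈ range (J + 1), if z + j < t - k then w z j else 0 :=
  Finset.sum_congr rfl fun z _ => Finset.sum_congr rfl fun j _ => by
    by_cases h : z + k + j < t
    · rw [if_pos h, if_pos (by omega)]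
    · rw [if_neg h, if_neg (by omega)]

/-- Evaluating the bit sum: `Σ_{z<2} f z = f 0 + f 1`. [folklore] -/
theorem sum_range_two (f : ℕ → ℝ) : (∑ z ∈ range 2, f z) = f 0 + f 1 := by
  rw [Finset.sum_range_succ, Finset.sum_range_succ, Finset.sum_range_zero, zero_add]


/-- **The k-level inequality** behind the window step.  Abstract data on `range n`: weights `u ≥ 0`, their window restriction `uW`
(`= u` on `W`, `= 0` off `W`), normalised first-slot means `F` (`= Fw` on `W`), second-slot means `G`, window terms `S` with
`Σ S ≥ −Σ uW`; all pairs inside `W` have `(F_k−F_{k'})(G_k−G_{k'}) ≥ 0` and all other pairs `≤ 0`.  Then the k-form of the restricted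
instance dominates: `0 ≤ (Σ uW)(Σ S − Σ uW Fw G) + (Σ uW Fw)(Σ uW G)` implies `0 ≤ (Σ u)(Σ S − Σ u F G) + (Σ u F)(Σ u G)`. [this work] -/
theorem klevel_ineq (n : ℕ) (u uW F Fw G S : ℕ → ℝ) (W : ℕ → Prop) [DecidablePred W] (hu : ∀ k, 0 ≤ u k)
    (huWon : ∀ k, W k → uW k = u k) (huWoff : ∀ k, ¬ W k → uW k = 0) (hFon : ∀ k, W k → F k = Fw k)
    (hin : ∀ k k', k < k' → k' < n → W k → W k' → 0 ≤ (F k - F k') * (G k - G k'))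
    (hout : ∀ k k', k < k' → k' < n → ¬ (W k ∧ W k') → (F k - F k') * (G k - G k') ≤ 0)
    (hS : -(∑ k ∈ range n, uW k) ≤ ∑ k ∈ range n, S k)
    (hW : 0 ≤ (∑ k ∈ range n, uW k) * ((∑ k ∈ range n, S k) - ∑ k ∈ range n, uW k * Fw k * G k) +
      (∑ k ∈ range n, uW k * Fw k) * (∑ k ∈ range n, uW k * G k)) :
    0 ≤ (∑ k ∈ range n, u k) * ((∑ k ∈ range n, S k) - ∑ k ∈ range n, u k * F k * G k) +
      (∑ k ∈ range n, u k * F k) * (∑ k ∈ range n, u k * G k) := by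
  have huW0 : ∀ k, 0 ≤ uW k := fun k => by
    by_cases h : W k
    · rw [huWon k h]; exact hu k
    · rw [huWoff k h]
  have huWle : ∀ k, uW k ≤ u k := fun k => by
    by_cases h : W k
    · rw [huWon k h]
    · rw [huWoff k h]; exact hu k
  have lag := lagrange_cov n u F G
  have lagW := lagrange_cov n uW Fw G
  obtain ⟨hpw1, hpw2⟩ := pairSum_le_window n u F G W hu hin hout
  have ePSW : (∑ k ∈ range n, ∑ k' ∈ range n, if k < k' then uW k * uW k' * (Fw k - Fw k') * (G k - G k') else 0) =
      ∑ k ∈ range n, ∑ k' ∈ range n, if k < k' ∧ W k ∧ W k' then u k * u k' * (F k - F k') * (G k - G k') else 0 := by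
    refine Finset.sum_congr rfl fun k _ => Finset.sum_congr rfl fun k' _ => ?_
    by_cases hlt : k < k'
    · by_cases hW2 : W k ∧ W k'
      · rw [if_pos hlt, if_pos ⟨hlt, hW2⟩, huWon k hW2.1, huWon k' hW2.2, hFon k hW2.1, hFon k' hW2.2]
      · rw [if_pos hlt, if_neg (fun h => hW2 h.2)]
        have : uW k * uW k' = 0 := by
          rcases not_and_or.1 hW2 with h | h
          · rw [huWoff k h, zero_mul]
          · rw [huWoff k' h, mul_zero]
        rw [this, zero_mul, zero_mul]
    · rw [if_neg hlt, if_neg (fun h => hlt h.1)]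
  set X := ∑ k ∈ range n, u k with hX
  set XW := ∑ k ∈ range n, uW k with hXW
  set SE := ∑ k ∈ range n, S k with hSEdef
  set PS := ∑ k ∈ range n, ∑ k' ∈ range n, if k < k' then u k * u k' * (F k - F k') * (G k - G k') else 0 with hPS
  set PSW := ∑ k ∈ range n, ∑ k' ∈ range n,
    if k < k' ∧ W k ∧ W k' then u k * u k' * (F k - F k') * (G k - G k') else 0 with hPSW
  have hXW0 : 0 ≤ XW := Finset.sum_nonneg fun k _ => huW0 k
  have hXWX : XW ≤ X := Finset.sum_le_sum fun k _ => huWle k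
  rw [ePSW] at lagW
  have eW : XW * (SE - ∑ k ∈ range n, uW k * Fw k * G k) +
      (∑ k ∈ range n, uW k * Fw k) * (∑ k ∈ range n, uW k * G k) = XW * SE - PSW := by
    rw [← lagW]; ring
  have hW' : 0 ≤ XW * SE - PSW := by rw [← eW]; exact hW
  have hSE0 : 0 ≤ SE := by
    by_contra hneg
    push Not at hneg
    have h1 : XW * SE ≥ 0 := by linarith
    have h2 : XW = 0 := by
      rcases hXW0.eq_or_lt with h | h
      · exact h.symm
      · exact absurd h1 (not_le.2 (mul_neg_of_pos_of_neg h hneg))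
    rw [h2] at hS
    linarith
  have hXSE : XW * SE ≤ X * SE := mul_le_mul_of_nonneg_right hXWX hSE0
  have eG : X * (SE - ∑ k ∈ range n, u k * F k * G k) +
      (∑ k ∈ range n, u k * F k) * (∑ k ∈ range n, u k * G k) = X * SE - PS := by
    rw [← lag]; ring
  rw [eG]
  linarith [hpw1, hpw2, hW', hXSE]


end ThreeChain

end SahiOneStep

end Summit.CriticalPhenomena.PercolationContinuityZ3.Theorems
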